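/-
Copyright (c) 2026 the pub-hodgecm-mathlib formalisation cell (harness21).  Prover seat hodgecm-mathlib-K2E4-p07 (g4) (E4 hand on E3's BONUS road (d-w) of ‹J3› v2,
road owner K2E3-p03 (g3); deal (C2b-i) «TOP INDEX `[U_an : K_an]`», second hand to K2E5-p16 (g3), 2026-09-04T03:34:55Z; corrected target 03:36:02Z ∕ 03:40:10Z):
FILE A — the maximal order of the wild quaternion model in COORDINATES.
-/
import Summits.HodgeConjecture.HodgeConjecture.Theorems.K2E3WildAnisotropicPlaneIndex   -- ★ p16 (K2E5-p16 (g3)): level bound `valued_le_exp_of_norm_sub_mul_norm_eq_one`, `le_exp_of_mul_self_lt_exp`; brings ★ NormSignConductor (deep norms, `exists_unit_v_sub_mul_map_le`), ★ dictionary `quatMat_mul`∕`det_quatMat`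
import Literature.NumberTheory.LocalFields.WildQuadraticDatumTraceBound                   -- ★ `trace_bound_pow_of_isRamifiedQuadraticDatum` (`|a + σa| ≤ |ϖ|^{d−1}|a|`: the different)
import HarnessLib

/-!
# K2 ∕ E3, road (d-w) of ‹J3› v2 — (C2b-i) FILE A `K2E3WildQuaternionOrder`: the maximal order `𝒪 = {x : |nrd x| ≤ 1}` of the quaternion model `q(a,b) = (a ξb; σb σa)` of the
# anisotropic plane, IN COORDINATES: `𝒪 = {q(c − b·e₀, b) : |c| ≤ 1, |b| ≤ |ϖ|^{−(d−1)}}`, `𝔓ⁿ = {|c| ≤ |ϖ|ⁿ, |b| ≤ |ϖ|^{n−(d−1)}}` (`N e₀ ≡ ξ mod ϖ^{2(d−1)}`)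

Cell `hodgecm-mathlib` (Track B «K2-LIT»), item h413 = `stmt-HodgeConjecture-24833`, route of record `route-HodgeConjecture-HCCMUnconditional`; PROOF lane (theorems only:
no `def`, no `instance`, no `notation`, no named fact, no `sorry`), `--supports stmt-HodgeConjecture-24833 --as helper`; count-neutral.  ROAD (d-w): (W3) ⟸ (C-ratio) ⟸ (C1) + (C2),
(C2) = (C2-struct) K2E5-p16 · (C2a) ★ p857092 · (C2b-i) THIS SEAT · (C2b-ii) K2E4-p14 (g4) (road owner K2E3-p03 (g3) 03:36:47Z).  (C2b-i) = the TOP INDEX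
`[U_an : K_an] = [S_an : S_an ∩ K_an] = [𝒪_D¹ : Λ¹] = (q+1)·q^{d−2}` (road owner's corrected target 03:36:02Z, d = 4 numerics `12` ✓); THIS FILE is its structural half.

THE MATHEMATICS (★ datum currency `IsRamifiedQuadraticDatum σ ϖ d t` on ONE complete field `K = E` with involution `σ`, `N z := z·σz`; `ξ` a `σ`-fixed unit which is NOT a norm).
The cyclic algebra `D = (E∕F, σ, ξ)` is realised by the matrices `q(a,b) = !![a, ξ b; σ b, σ a]` (★ `quatMat_mul`, `det_quatMat`: `nrd = det = N a − ξ N b`, `trd = tr = a + σa`); it is a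
DIVISION algebra (`N a = ξ N b ⇒ a = b = 0`).  Its maximal order is `𝒪 := {q(a,b) : |N a − ξ N b| ≤ 1}`, with `𝔓ⁿ := {|N a − ξ N b| ≤ |ϖ|^{2n}}`; `Λ := {q(a,b) : a, b ∈ 𝒪_E}`.
* §1 **LEVEL BOUND WITH A GENERAL VALUE** (★ p16 §1's proof run for `N α − ξ N β = δ`, any `δ ≠ 0`): `|β|² ≤ |δ|·|ϖ|^{−2(d−1)}`, `|α|² ≤ |δ|·|ϖ|^{−2(d−1)}` — so `𝒪 ⊆ ϖ_E^{−(d−1)}Λ` and `𝔓ⁿ ⊆ ϖ_E^{n−(d−1)}Λ`; anisotropy `N α = ξ N β ⇒ α = β = 0`.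
* §2 **`nrd` IS ULTRAMETRIC ON `D`**: `|det(x + y)| ≤ max(|det x|, |det y|)` for `x, y` in the model — `x + y = y(1 + z)`, `z = y⁻¹x` in the model with `|det z| ≤ 1`, hence (§1) `z`'s first coordinate has `|z₁| ≤ |ϖ|^{−(d−1)}` and (the DIFFERENT, ★ `trace_bound_pow_of_isRamifiedQuadraticDatum`) `|tr z| = |z₁ + σz₁| ≤ 1`, and `det(1 + z) = 1 + tr z + det z`. So `𝒪` and every `𝔓ⁿ` are additive groups (and `𝒪·𝔓ⁿ ⊆ 𝔓ⁿ` trivially).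
* §3 **COORDINATES**: ★ `exists_unit_v_sub_mul_map_le` gives a unit `e₀ ∈ 𝒪_E` with `|N e₀ − ξ| ≤ |ϖ|^{2(d−1)}` (the conductor of `E∕F` is `d`: `ξ ∈ N(U_E)·U_F^{(d−1)}`); then for every `n ∈ ℤ`: **`|N a − ξ N b| ≤ |ϖ|^{2n} ⟺ |b| ≤ |ϖ|^{n−(d−1)} ∧ |a + b e₀| ≤ |ϖ|ⁿ`** (`q(a,b) = q(a + be₀, 0) − q(b, 0)·q(e₀, −1)`, `det q(e₀,−1) = N e₀ − ξ`, §2 both ways).  In the coordinates `(c, b) := (a + b e₀, b)` the order is the BOX `𝒪 ↔ B(1) × B(|ϖ|^{−(d−1)})`, `𝔓ⁿ ↔ B(|ϖ|ⁿ) × B(|ϖ|^{n−(d−1)})`, `Λ ↔ B(1) × B(1)` (= `𝒪_E + 𝔓^{d−1}`), `[𝒪 : Λ] = q^{d−1}`, `Λ ∩ 𝔓 ↔ B(|ϖ|) × B(1)` (residue field of `Λ` is `𝔽_q` — `√ξ̄ ∈ 𝔽_q` as `q` is even; here it is just the box), and FILE B counts units against these boxes.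
[cite: Serre1979, Ch. V §3 Prop. 5, Cor. 2–3; Ch. III §3 Prop. 7; Ch. XV §2] [cite: VignerasLNM800, Ch. II §1 Thm. 1.4, §4] [cite: Rogawski1990, §3.8 p. 33]
HONEST LABEL: HC_CM is proved only modulo the 7 printed citations (2 remaining named inputs: hLiu418 = stmt-HodgeConjecture-24832, h413 = stmt-HodgeConjecture-24833) until rung 0
closes; (C2b-i), (C2), (W3) are NOT proved here — structural input, count-neutral.

## References
* [Serre1979] J.-P. Serre, *Local Fields*, GTM 67 (1979) — Ch. III §3, Ch. V §3, Ch. XV §2.  * [VignerasLNM800] M.-F. Vignéras, *Arithmétique des algèbres de quaternions*, LNM 800 (1980) — Ch. II §1.  * [Rogawski1990] J. D. Rogawski, *Automorphic Representations of Unitary Groups in Three Variables* (1990) — §3.8 p. 33.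
-/

set_option autoImplicit false
set_option linter.dupNamespace false

noncomputable section

namespace Summit.HodgeConjecture.HodgeConjecture.Cruxes.H413.K2E3WildQuaternionOrder

open WithZero
open scoped Valued Matrix
open Literature.NumberTheory.Automorphic Literature.NumberTheory.Automorphic.UnitaryGroup
open Literature.NumberTheory.Automorphic.UnitaryThreeFourFrame (IsRamifiedQuadraticDatum)
open Literature.NumberTheory.LocalFields.WildQuadraticDatum
open Summit.HodgeConjecture.HodgeConjecture.Cruxes.H413.K2E3WildAnisotropicPlaneIndex (le_exp_of_mul_self_lt_exp exp_le_of_exp_le_mul_self)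
open Summit.HodgeConjecture.HodgeConjecture.Cruxes.H413 (K2E3WildAnisotropicPlaneNonIntegral.two_le_d_of_valued_two_lt_one)

section Datum

variable {K : Type} [Field K] [Valued K ℤᵐ⁰] {σ : K →+* K} {ϖ : K} {d t : ℕ}

/-! ## §0 `ℤᵐ⁰` helpers -/

omit [Valued K ℤᵐ⁰] in
/-- `N z = z·σz` is `σ`-fixed (★ `map_mul_map`), hence so is `N a − ξ N b` for fixed `ξ`. [cite: Serre1979, Ch. V §3] -/
theorem map_norm_sub_mul_norm (hσ : ∀ x, σ (σ x) = x) {ξ : K} (hσξ : σ ξ = ξ) (a b : K) :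
    σ (a * σ a - ξ * (b * σ b)) = a * σ a - ξ * (b * σ b) := by
  simp only [map_sub, map_mul, hσ, hσξ]; ring

/-- In `ℤᵐ⁰`: `γ² ≤ exp(2n) ⇒ γ ≤ exp n`. [cite: Serre1979, Ch. II §1] -/
theorem le_exp_of_mul_self_le_exp {γ : ℤᵐ⁰} {n : ℤ} (h : γ * γ ≤ exp (2 * n)) : γ ≤ exp n := by
  rcases eq_or_ne γ 0 with rfl | hγ
  · exact zero_le
  obtain ⟨k, hk⟩ : ∃ k : ℤ, γ = exp k := ⟨_, (exp_log hγ).symm⟩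
  rw [hk, ← exp_add, exp_le_exp] at h
  rw [hk, exp_le_exp]
  omega

/-! ## §1 The level bound with a general value, anisotropy -/

omit [Valued K ℤᵐ⁰] in
/-- **ANISOTROPY**: `N α − ξ N β = 0 ⇒ α = 0 ∧ β = 0` for a non-norm `ξ`. [cite: Rogawski1990, §3.8 p. 33] -/
theorem eq_zero_of_norm_sub_mul_norm_eq_zero {ξ : K} (hξN : ¬ ∃ z : K, z * σ z = ξ) {α β : K} (h : α * σ α - ξ * (β * σ β) = 0) :
    α = 0 ∧ β = 0 := by
  by_cases hβ : β = 0
  · subst hβ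
    have : α * σ α = 0 := by simpa using h
    rcases mul_eq_zero.1 this with hα | hα
    · exact ⟨hα, rfl⟩
    · exact ⟨(map_eq_zero σ).1 hα, rfl⟩
  · exfalso
    refine hξN ⟨α / β, ?_⟩
    have hσβ : σ β ≠ 0 := (map_ne_zero σ).2 hβ
    rw [map_div₀, div_mul_div_comm, div_eq_iff (mul_ne_zero hβ hσβ)]
    linear_combination h

/-- **LEVEL BOUND WITH A GENERAL VALUE.**  At a ramified datum over a complete field, `ξ` a fixed unit non-norm: `N α − ξ N β = δ ≠ 0 ⇒ |β|² ≤ |δ|·|ϖ|^{−2(d−1)}` and `|α|² ≤ |δ|·|ϖ|^{−2(d−1)}` (★ p16's bounded-denominators argument: if `|ξNβ| > |δ|` then `|Nα| = |Nβ| = R`, `x = Nα∕(ξNβ)` is a fixed non-norm with `|x − 1| = |δ|∕R`, and deep norms ★ `exists_mul_map_eq_of_fixed_of_v_sub_one_le_pred` force `|δ|∕R > |ϖ|^{2d−1}`; parity of fixed valuations rounds `R < |δ|·|ϖ|^{−(2d−1)}` to `R ≤ |δ|·|ϖ|^{−(2d−2)}`). [cite: Serre1979, Ch. V §3 Prop.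 5, Cor. 3; Ch. XV §2] [cite: VignerasLNM800, Ch. II §1] -/
theorem v_mul_v_le_of_norm_sub_mul_norm_eq [CompleteSpace K] (hD : IsRamifiedQuadraticDatum σ ϖ d t)
    {ξ : K} (hσξ : σ ξ = ξ) (hξ1 : Valued.v ξ = 1) (hξN : ¬ ∃ z : K, z * σ z = ξ)
    {α β δ : K} (h : α * σ α - ξ * (β * σ β) = δ) (hδ : δ ≠ 0) :
    Valued.v β * Valued.v β ≤ Valued.v δ * exp (2 * ((d - 1 : ℕ) : ℤ)) ∧ Valued.v α * Valued.v α ≤ Valued.v δ * exp (2 * ((d - 1 : ℕ) : ℤ)) := by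
  have hD' := hD
  obtain ⟨hσ, hvσ, hϖ, hfix, -, hd1, -⟩ := hD'
  have hξ0 : ξ ≠ 0 := fun h0 => by rw [h0, map_zero] at hξ1; exact zero_ne_one hξ1
  have hσδ : σ δ = δ := by rw [← h]; exact map_norm_sub_mul_norm hσ hσξ α β
  have hvδ0 : Valued.v δ ≠ 0 := (Valuation.ne_zero_iff _).2 hδ
  have h1le : (1 : ℤᵐ⁰) ≤ exp (2 * ((d - 1 : ℕ) : ℤ)) := by rw [← exp_zero, exp_le_exp]; positivity
  have hNα : α * σ α = δ + ξ * (β * σ β) := by linear_combination h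
  by_cases hβδ : Valued.v (β * σ β) ≤ Valued.v δ
  · -- small `β`: `|Nα| ≤ |δ|`
    refine ⟨?_, ?_⟩
    · rw [map_mul, hvσ] at hβδ
      exact hβδ.trans (le_mul_of_one_le_right' h1le)
    · have hα2 : Valued.v (α * σ α) ≤ Valued.v δ := by
        rw [hNα]
        refine (Valuation.map_add _ _ _).trans (max_le le_rfl ?_)
        rw [map_mul, hξ1, one_mul]; exact hβδ
      rw [map_mul, hvσ] at hα2
      exact hα2.trans (le_mul_of_one_le_right' h1le)
  · -- large `β`: `|Nα| = |ξNβ| = R > |δ|`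
    rw [not_le] at hβδ
    have hR0 : β * σ β ≠ 0 := fun h0 => by rw [h0, map_zero] at hβδ; exact not_lt_zero hβδ
    have hβ0 : β ≠ 0 := fun h0 => hR0 (by rw [h0, zero_mul])
    have hden : ξ * (β * σ β) ≠ 0 := mul_ne_zero hξ0 hR0
    have hvden : Valued.v (ξ * (β * σ β)) = Valued.v (β * σ β) := by rw [map_mul, hξ1, one_mul]
    have hvNα : Valued.v (α * σ α) = Valued.v (β * σ β) := by
      rw [hNα, Valuation.map_add_eq_of_lt_right, hvden]
      rw [hvden]; exact hβδ
    have hNα0 : α * σ α ≠ 0 := fun h0 => by rw [h0, map_zero] at hvNα; exact hR0 ((Valuation.zero_iff _).1 hvNα.symm)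
    -- the fixed non-norm `x = Nα / (ξ Nβ)` with `x − 1 = δ / (ξ Nβ)`
    have hσx : σ (α * σ α / (ξ * (β * σ β))) = α * σ α / (ξ * (β * σ β)) := by
      rw [map_div₀, map_mul σ ξ, hσξ, map_mul_map hσ α, map_mul_map hσ β]
    have hx1 : α * σ α / (ξ * (β * σ β)) - 1 = δ / (ξ * (β * σ β)) := by rw [div_sub_one hden, h]
    have hvx1 : Valued.v (α * σ α / (ξ * (β * σ β)) - 1) = Valued.v δ * (Valued.v (β * σ β))⁻¹ := by
      rw [hx1, map_div₀, hvden, div_eq_mul_inv]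
    have hxN : ¬ ∃ z : K, z * σ z = α * σ α / (ξ * (β * σ β)) := by
      rintro ⟨z, hz⟩
      have hz0 : z ≠ 0 := by
        rintro rfl
        rw [zero_mul] at hz
        exact div_ne_zero hNα0 hden hz.symm
      have hxden : z * σ z * (ξ * (β * σ β)) = α * σ α := by rw [hz, div_mul_cancel₀ _ hden]
      refine hξN ⟨α / (z * β), ?_⟩
      rw [map_div₀, map_mul, div_mul_div_comm, ← hxden, div_eq_iff (mul_ne_zero (mul_ne_zero hz0 hβ0) (mul_ne_zero ((map_ne_zero σ).2 hz0) ((map_ne_zero σ).2 hβ0)))]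
      ring
    -- deep norms: `|x − 1| > |ϖ|^{2d−1}`, i.e. `R·|ϖ|^{2d−1} < |δ|`
    have hlt : Valued.v ϖ ^ (2 * d - 1) < Valued.v (α * σ α / (ξ * (β * σ β)) - 1) := by
      by_contra hle
      rw [not_lt] at hle
      exact hxN (exists_mul_map_eq_of_fixed_of_v_sub_one_le_pred hD hσx (n := 2 * d - 1) le_rfl hle)
    -- exponents: `|δ| = exp(2m)`, `R = |Nβ| = exp(2r)` (fixed elements have even valuation)
    obtain ⟨m, hm⟩ := hfix δ hσδ hδ
    obtain ⟨r, hr⟩ := hfix (β * σ β) (map_mul_map hσ β) hR0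
    rw [hvx1, v_varpi_pow hϖ, hm, hr, ← exp_neg, ← exp_add, exp_lt_exp] at hlt
    have hRle' : Valued.v (β * σ β) ≤ Valued.v δ * exp (2 * ((d - 1 : ℕ) : ℤ)) := by
      rw [hr, hm, ← exp_add, exp_le_exp]; omega
    refine ⟨?_, ?_⟩
    · rw [map_mul, hvσ] at hRle'; exact hRle'
    · rw [← hvNα, map_mul, hvσ] at hRle'; exact hRle'

/-- **THE LEVEL OF `𝔓ⁿ`**: `|N a − ξ N b| ≤ |ϖ|^{2n} ⇒ |b| ≤ |ϖ|^{n−(d−1)} ∧ |a| ≤ |ϖ|^{n−(d−1)}` (`n ∈ ℤ`; §1 + anisotropy). [cite: VignerasLNM800, Ch. II §1] [cite: Serre1979, Ch. V §3] -/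
theorem v_le_exp_of_v_norm_sub_mul_norm_le [CompleteSpace K] (hD : IsRamifiedQuadraticDatum σ ϖ d t)
    {ξ : K} (hσξ : σ ξ = ξ) (hξ1 : Valued.v ξ = 1) (hξN : ¬ ∃ z : K, z * σ z = ξ)
    {a b : K} {n : ℤ} (h : Valued.v (a * σ a - ξ * (b * σ b)) ≤ exp (2 * n)) :
    Valued.v b ≤ exp (n + ((d - 1 : ℕ) : ℤ)) ∧ Valued.v a ≤ exp (n + ((d - 1 : ℕ) : ℤ)) := by
  rcases eq_or_ne (a * σ a - ξ * (b * σ b)) 0 with h0 | hδ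
  · obtain ⟨rfl, rfl⟩ := eq_zero_of_norm_sub_mul_norm_eq_zero hξN h0
    simp
  obtain ⟨hb, ha⟩ := v_mul_v_le_of_norm_sub_mul_norm_eq hD hσξ hξ1 hξN rfl hδ
  have hbd : Valued.v (a * σ a - ξ * (b * σ b)) * exp (2 * ((d - 1 : ℕ) : ℤ)) ≤ exp (2 * (n + ((d - 1 : ℕ) : ℤ))) := by
    rw [show 2 * (n + ((d - 1 : ℕ) : ℤ)) = 2 * n + 2 * ((d - 1 : ℕ) : ℤ) by ring, exp_add]
    gcongr
  exact ⟨le_exp_of_mul_self_le_exp (hb.trans hbd), le_exp_of_mul_self_le_exp (ha.trans hbd)⟩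

/-! ## §2 `nrd` is ultrametric on the model -/

omit [Valued K ℤᵐ⁰] in
/-- **Multiplicativity of `nrd` in the model** (the two-norm identity of the cyclic algebra): `N(pa + ξ r σb) − ξ N(pb + r σa) = (N p − ξ N r)(N a − ξ N b)` — `det` of ★ `quatMat_mul`. [cite: Rogawski1990, §3.8 p. 33] -/
theorem norm_sub_mul_norm_quatMul (hσ : ∀ x, σ (σ x) = x) {ξ : K} (hσξ : σ ξ = ξ) (p r a b : K) :
    (p * a + ξ * (r * σ b)) * σ (p * a + ξ * (r * σ b)) - ξ * ((p * b + r * σ a) * σ (p * b + r * σ a)) =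
      (p * σ p - ξ * (r * σ r)) * (a * σ a - ξ * (b * σ b)) := by
  simp only [map_add, map_mul, hσ, hσξ]; ring

/-- **`|det(x + y)| ≤ max(|det x|, |det y|)` on the model** (auxiliary, `|det x| ≤ |det y|`, `y ≠ 0`): with `z₁ := (σc·a − ξ e σb)∕det y` the first coordinate of `z = y⁻¹x`, `det(x + y) = det y · (1 + tr z) + det x`, `|z₁| ≤ |ϖ|^{−(d−1)}` (§1 at `|det z| ≤ 1`) and `|tr z| ≤ 1` (the different ★ `trace_bound_pow_of_isRamifiedQuadraticDatum`). [cite: VignerasLNM800, Ch. II §1 Thm. 1.4] [cite: Serre1979, Ch. III §3 Prop. 7] -/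
theorem v_norm_sub_mul_norm_add_le_of_le [CompleteSpace K] (hD : IsRamifiedQuadraticDatum σ ϖ d t)
    {ξ : K} (hσξ : σ ξ = ξ) (hξ1 : Valued.v ξ = 1) (hξN : ¬ ∃ z : K, z * σ z = ξ) {a b c e : K}
    (hy : c * σ c - ξ * (e * σ e) ≠ 0) (hle : Valued.v (a * σ a - ξ * (b * σ b)) ≤ Valued.v (c * σ c - ξ * (e * σ e))) :
    Valued.v ((a + c) * σ (a + c) - ξ * ((b + e) * σ (b + e))) ≤ Valued.v (c * σ c - ξ * (e * σ e)) := by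
  have hD' := hD
  obtain ⟨hσ, hvσ, hϖ, -, -, -, -⟩ := hD'
  set δx := a * σ a - ξ * (b * σ b) with hδx
  set δy := c * σ c - ξ * (e * σ e) with hδy
  have hσδy : σ δy = δy := map_norm_sub_mul_norm hσ hσξ c e
  -- `z = y⁻¹ x = q(p, r)·q(a, b)` with `p = σc∕δy`, `r = −e∕δy`
  set p : K := σ c / δy with hp
  set r : K := -e / δy with hr
  have hNpr : p * σ p - ξ * (r * σ r) = δy⁻¹ := by
    rw [hp, hr, map_div₀, map_div₀, hσ, hσδy, map_neg]
    field_simp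
    rw [hδy]; ring
  set z₁ := p * a + ξ * (r * σ b) with hz₁
  set z₂ := p * b + r * σ a with hz₂
  have hdetz : z₁ * σ z₁ - ξ * (z₂ * σ z₂) = δy⁻¹ * δx := by rw [hz₁, hz₂, norm_sub_mul_norm_quatMul hσ hσξ, hNpr]
  have hvz : Valued.v (z₁ * σ z₁ - ξ * (z₂ * σ z₂)) ≤ exp (2 * 0) := by
    rw [hdetz, map_mul, map_inv₀, mul_zero, exp_zero]
    exact (inv_mul_le_one₀ (lt_of_le_of_ne zero_le ((Valuation.ne_zero_iff _).2 hy).symm)).2 hle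
  obtain ⟨-, hz₁le⟩ := v_le_exp_of_v_norm_sub_mul_norm_le hD hσξ hξ1 hξN hvz
  rw [zero_add] at hz₁le
  -- the different: `|tr z| ≤ 1`
  have htr : Valued.v (z₁ + σ z₁) ≤ 1 := by
    refine (trace_bound_pow_of_isRamifiedQuadraticDatum hD z₁).trans ?_
    rw [v_varpi_pow hϖ]
    calc exp (-((d - 1 : ℕ) : ℤ)) * Valued.v z₁ ≤ exp (-((d - 1 : ℕ) : ℤ)) * exp (((d - 1 : ℕ) : ℤ)) := by gcongr
      _ = 1 := by rw [← exp_add, neg_add_cancel, exp_zero]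
  -- `det(x + y) = δy (1 + tr z) + δx`
  have hsum : (a + c) * σ (a + c) - ξ * ((b + e) * σ (b + e)) = δy * (1 + (z₁ + σ z₁)) + δx := by
    have hσz₁ : δy * σ z₁ = c * σ a - ξ * (σ e * b) := by
      rw [hz₁, hp, hr]
      simp only [map_add, map_mul, map_div₀, map_neg, hσ, hσξ, hσδy]
      field_simp
      ring
    have hz₁' : δy * z₁ = σ c * a - ξ * (e * σ b) := by
      rw [hz₁, hp, hr]; field_simp; ring
    calc (a + c) * σ (a + c) - ξ * ((b + e) * σ (b + e))
        = δy + (σ c * a - ξ * (e * σ b)) + (c * σ a - ξ * (σ e * b)) + δx := by rw [hδx, hδy, map_add, map_add]; ring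
      _ = δy * (1 + (z₁ + σ z₁)) + δx := by rw [← hz₁', ← hσz₁]; ring
  rw [hsum]
  refine (Valuation.map_add _ _ _).trans (max_le ?_ hle)
  rw [map_mul]
  refine mul_le_of_le_one_right' ((Valuation.map_add _ _ _).trans (max_le (by rw [map_one]) htr))

/-- **`nrd` IS ULTRAMETRIC ON THE MODEL**: `|det(q(a,b) + q(c,e))| ≤ max(|det q(a,b)|, |det q(c,e)|)` — so `𝒪 = {|det| ≤ 1}` and every `𝔓ⁿ` are additive groups. [cite: VignerasLNM800, Ch. II §1 Thm. 1.4] [cite: Serre1979, Ch. III §3 Prop. 7] -/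
theorem v_norm_sub_mul_norm_add_le_max [CompleteSpace K] (hD : IsRamifiedQuadraticDatum σ ϖ d t)
    {ξ : K} (hσξ : σ ξ = ξ) (hξ1 : Valued.v ξ = 1) (hξN : ¬ ∃ z : K, z * σ z = ξ) (a b c e : K) :
    Valued.v ((a + c) * σ (a + c) - ξ * ((b + e) * σ (b + e))) ≤
      max (Valued.v (a * σ a - ξ * (b * σ b))) (Valued.v (c * σ c - ξ * (e * σ e))) := by
  rcases le_total (Valued.v (a * σ a - ξ * (b * σ b))) (Valued.v (c * σ c - ξ * (e * σ e))) with hle | hle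
  · rcases eq_or_ne (c * σ c - ξ * (e * σ e)) 0 with hy | hy
    · obtain ⟨rfl, rfl⟩ := eq_zero_of_norm_sub_mul_norm_eq_zero hξN hy
      simp
    · exact (v_norm_sub_mul_norm_add_le_of_le hD hσξ hξ1 hξN hy hle).trans (le_max_right _ _)
  · rcases eq_or_ne (a * σ a - ξ * (b * σ b)) 0 with hx | hx
    · obtain ⟨rfl, rfl⟩ := eq_zero_of_norm_sub_mul_norm_eq_zero hξN hx
      simp
    · have h := v_norm_sub_mul_norm_add_le_of_le hD hσξ hξ1 hξN hx hle
      rw [add_comm c a, add_comm e b] at h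
      exact h.trans (le_max_left _ _)

/-! ## §3 Coordinates: `𝔓ⁿ ↔ B(|ϖ|ⁿ) × B(|ϖ|^{n−(d−1)})` -/

/-- **`𝔓ⁿ` FROM THE COORDINATES**: for a unit `e₀` with `|N e₀ − ξ| ≤ |ϖ|^{2(d−1)}` (★ `exists_unit_v_sub_mul_map_le`: the conductor of `E∕F` is `d`), `|c| ≤ exp n` and `|b| ≤ exp(n + (d−1))` give `|N(c − b e₀) − ξ N b| ≤ exp(2n)`: `N(c − be₀) − ξNb = Nc − (w + σw) + Nb·(Ne₀ − ξ)`, `w = c·σb·σe₀`, `|w + σw| ≤ |ϖ|^{d−1}|w|` (the different). [cite: Serre1979, Ch. III §3 Prop. 7; Ch. V §3 Cor. 3] [cite: VignerasLNM800, Ch. II §1] -/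
theorem v_norm_sub_mul_norm_le_of_coords (hD : IsRamifiedQuadraticDatum σ ϖ d t) {ξ : K}
    {e₀ : K} (he₀1 : Valued.v e₀ ≤ 1) (he₀ : Valued.v (ξ - e₀ * σ e₀) ≤ exp (-(2 * ((d - 1 : ℕ) : ℤ))))
    {c b : K} {n : ℤ} (hc : Valued.v c ≤ exp n) (hb : Valued.v b ≤ exp (n + ((d - 1 : ℕ) : ℤ))) :
    Valued.v ((c - b * e₀) * σ (c - b * e₀) - ξ * (b * σ b)) ≤ exp (2 * n) := by
  have hD' := hD
  obtain ⟨hσ, hvσ, hϖ, -, -, -, -⟩ := hD'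
  set w := c * (σ b * σ e₀) with hw
  have hσw : σ w = σ c * (b * e₀) := by rw [hw, map_mul, map_mul, hσ, hσ]
  have hexp : (c - b * e₀) * σ (c - b * e₀) - ξ * (b * σ b) = c * σ c - (w + σ w) + b * σ b * (e₀ * σ e₀ - ξ) := by
    rw [hσw, hw, map_sub, map_mul]; ring
  rw [hexp]
  have h1 : Valued.v (c * σ c) ≤ exp (2 * n) := by
    rw [map_mul, hvσ, two_mul, exp_add]; exact mul_le_mul' hc hc
  have h2 : Valued.v (w + σ w) ≤ exp (2 * n) := by
    refine (trace_bound_pow_of_isRamifiedQuadraticDatum hD w).trans ?_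
    rw [v_varpi_pow hϖ, hw, map_mul, map_mul, hvσ, hvσ]
    calc exp (-((d - 1 : ℕ) : ℤ)) * (Valued.v c * (Valued.v b * Valued.v e₀))
        ≤ exp (-((d - 1 : ℕ) : ℤ)) * (exp n * (exp (n + ((d - 1 : ℕ) : ℤ)) * 1)) := by gcongr
      _ = exp (2 * n) := by rw [mul_one, ← exp_add, ← exp_add]; congr 1; ring
  have h3 : Valued.v (b * σ b * (e₀ * σ e₀ - ξ)) ≤ exp (2 * n) := by
    rw [map_mul, map_mul, hvσ, ← Valuation.map_neg _ (e₀ * σ e₀ - ξ), neg_sub]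
    calc Valued.v b * Valued.v b * Valued.v (ξ - e₀ * σ e₀)
        ≤ exp (n + ((d - 1 : ℕ) : ℤ)) * exp (n + ((d - 1 : ℕ) : ℤ)) * exp (-(2 * ((d - 1 : ℕ) : ℤ))) := by gcongr
      _ = exp (2 * n) := by rw [← exp_add, ← exp_add]; congr 1; ring
  refine (Valuation.map_add _ _ _).trans (max_le ((Valuation.map_sub _ _ _).trans (max_le h1 h2)) h3)

/-- **THE COORDINATES FROM `𝔓ⁿ`**: `|N a − ξ N b| ≤ exp(2n) ⇒ |b| ≤ exp(n + (d−1))` and `|a + b e₀| ≤ exp n` — `q(a + be₀, 0) = q(a,b) + q(be₀, −b)` with `det q(be₀, −b) = Nb·(Ne₀ − ξ)`, and `nrd` is ultrametric (§2). [cite: VignerasLNM800, Ch. II §1] [cite: Serre1979, Ch. V §3 Cor. 3] -/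
theorem coords_of_v_norm_sub_mul_norm_le [CompleteSpace K] (hD : IsRamifiedQuadraticDatum σ ϖ d t)
    {ξ : K} (hσξ : σ ξ = ξ) (hξ1 : Valued.v ξ = 1) (hξN : ¬ ∃ z : K, z * σ z = ξ)
    {e₀ : K} (he₀ : Valued.v (ξ - e₀ * σ e₀) ≤ exp (-(2 * ((d - 1 : ℕ) : ℤ))))
    {a b : K} {n : ℤ} (h : Valued.v (a * σ a - ξ * (b * σ b)) ≤ exp (2 * n)) :
    Valued.v b ≤ exp (n + ((d - 1 : ℕ) : ℤ)) ∧ Valued.v (a + b * e₀) ≤ exp n := by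
  have hD' := hD
  obtain ⟨hσ, hvσ, -, -, -, -, -⟩ := hD'
  obtain ⟨hb, -⟩ := v_le_exp_of_v_norm_sub_mul_norm_le hD hσξ hξ1 hξN h
  refine ⟨hb, ?_⟩
  -- `det q(be₀, −b) = Nb (Ne₀ − ξ)`
  have hdet' : Valued.v ((b * e₀) * σ (b * e₀) - ξ * ((-b) * σ (-b))) ≤ exp (2 * n) := by
    have hexp : (b * e₀) * σ (b * e₀) - ξ * ((-b) * σ (-b)) = -(b * σ b * (ξ - e₀ * σ e₀)) := by rw [map_mul, map_neg]; ring
    rw [hexp, Valuation.map_neg, map_mul, map_mul, hvσ]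
    calc Valued.v b * Valued.v b * Valued.v (ξ - e₀ * σ e₀)
        ≤ exp (n + ((d - 1 : ℕ) : ℤ)) * exp (n + ((d - 1 : ℕ) : ℤ)) * exp (-(2 * ((d - 1 : ℕ) : ℤ))) := by gcongr
      _ = exp (2 * n) := by rw [← exp_add, ← exp_add]; congr 1; ring
  have hsum := v_norm_sub_mul_norm_add_le_max hD hσξ hξ1 hξN a b (b * e₀) (-b)
  rw [add_neg_cancel, zero_mul, mul_zero, sub_zero, map_mul, hvσ] at hsum
  exact le_exp_of_mul_self_le_exp ((hsum.trans (max_le h hdet')))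

/-! ## §4 `nrd(Λ^×) = nrd(𝒪^×)`: every `σ`-fixed unit is the reduced norm of an INTEGRAL pair -/

/-- **A `Λ`-ELEMENT OF REDUCED NORM `ξ` AT A WILD PLACE**: `∃ a₀, z ∈ 𝒪_E` with `N a₀ − ξ N z = ξ`.  The conductor of `E∕F` is `d`: the ★ sharp non-norm fixed unit `c ≡ 1 (ϖ^{2d−2})` has `c − 1 ≡ N z` with `|c ∕ (1 + Nz) − 1| ≤ |ϖ|^{4(d−1)} ≤ |ϖ|^{2d−1}` (★ `exists_unit_v_sub_mul_map_le` on the unit part of `c − 1`), so `c∕(1 + Nz)` is a norm (★ deep norms) and `1 + N z` is NOT; by index two (★ `exists_nonnorm_dichotomy`) `ξ·(1 + Nz) = N a₀`, and `N a₀ − ξ N z = ξ`. [cite: Serre1979, Ch. V §3 Prop. 5, Cor. 3; Ch. XV §2] -/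
theorem exists_integral_norm_sub_mul_norm_eq_self [CompleteSpace K] [Finite 𝓀[K]] (hD : IsRamifiedQuadraticDatum σ ϖ d t) (h2 : Valued.v (2 : K) < 1)
    {ξ : K} (hσξ : σ ξ = ξ) (hξ1 : Valued.v ξ = 1) (hξN : ¬ ∃ z : K, z * σ z = ξ) :
    ∃ a₀ z : K, Valued.v a₀ ≤ 1 ∧ Valued.v z ≤ 1 ∧ a₀ * σ a₀ - ξ * (z * σ z) = ξ := by
  have hD' := hD
  obtain ⟨hσ, hvσ, hϖ, hfix, -, hd1, -⟩ := hD'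
  have h2d : 2 ≤ d := K2E3WildAnisotropicPlaneNonIntegral.two_le_d_of_valued_two_lt_one hD h2
  have hϖ0 : ϖ ≠ 0 := fun h0 => by rw [h0, map_zero] at hϖ; exact (exp_ne_zero hϖ.symm).elim
  -- (1) the sharp non-norm `c`
  obtain ⟨c, hσc, hc1, hcle, hcN⟩ := exists_fixed_unit_not_norm_v_sub_one_le hD h2
  set y₀ := c - 1 with hy₀
  have hσy₀ : σ y₀ = y₀ := by rw [hy₀, map_sub, hσc, map_one]
  have hy₀0 : y₀ ≠ 0 := by
    intro h0
    refine hcN ⟨1, ?_⟩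
    rw [map_one, one_mul]; exact (sub_eq_zero.1 h0).symm
  obtain ⟨k, hk⟩ := hfix y₀ hσy₀ hy₀0
  have hkle : k ≤ -((d - 1 : ℕ) : ℤ) := by
    have := hcle; rw [hk, exp_le_exp] at this; omega
  -- (2) the unit part `w = y₀ ∕ (ϖσϖ)^m`, `m = −k ≥ d − 1`
  set m : ℕ := (-k).toNat with hm
  have hmk : (m : ℤ) = -k := by rw [hm, Int.toNat_of_nonneg (by omega)]
  have hNϖ : Valued.v ((ϖ * σ ϖ) ^ m) = exp (-(2 * (m : ℤ))) := v_normVarpi_pow hvσ hϖ m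
  have hNϖ0 : (ϖ * σ ϖ) ^ m ≠ 0 := pow_ne_zero _ (mul_ne_zero hϖ0 ((map_ne_zero σ).2 hϖ0))
  set w := y₀ / (ϖ * σ ϖ) ^ m with hw
  have hσw : σ w = w := by rw [hw, map_div₀, hσy₀, map_pow, map_mul, hσ, mul_comm (σ ϖ) ϖ]
  have hw1 : Valued.v w = 1 := by
    rw [hw, map_div₀, hk, hNϖ, ← exp_sub, hmk]; convert exp_zero; ring
  obtain ⟨z₁, hz₁1, hz₁⟩ := exists_unit_v_sub_mul_map_le hD h2 hσw hw1
  -- (3) `z = ϖ^m z₁`, `|y₀ − N z| ≤ exp(−4(d−1))`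
  set z := ϖ ^ m * z₁ with hz
  have hNz : z * σ z = (ϖ * σ ϖ) ^ m * (z₁ * σ z₁) := by rw [hz, map_mul, map_pow]; ring
  have hvNz : Valued.v (z * σ z) < 1 := by
    rw [hNz, map_mul, hNϖ, map_mul, hvσ, hz₁1, mul_one, mul_one, ← exp_zero, exp_lt_exp]; omega
  have hdiff : Valued.v (y₀ - z * σ z) ≤ exp (-(4 * ((d - 1 : ℕ) : ℤ))) := by
    have : y₀ - z * σ z = (ϖ * σ ϖ) ^ m * (w - z₁ * σ z₁) := by rw [hNz, hw, mul_sub, mul_div_cancel₀ _ hNϖ0]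
    rw [this, map_mul, hNϖ]
    calc exp (-(2 * (m : ℤ))) * Valued.v (w - z₁ * σ z₁) ≤ exp (-(2 * (m : ℤ))) * exp (-(2 * ((d - 1 : ℕ) : ℤ))) := by gcongr
      _ ≤ exp (-(4 * ((d - 1 : ℕ) : ℤ))) := by rw [← exp_add, exp_le_exp]; omega
  -- (4) `u = c ∕ (1 + Nz)` is a deep fixed unit, hence a norm
  have hlt1 : Valued.v (z * σ z) < Valued.v (1 : K) := by rw [map_one]; exact hvNz
  have h1Nz1 : Valued.v (1 + z * σ z) = 1 := by rw [Valuation.map_add_eq_of_lt_left _ hlt1, map_one]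
  have h1Nz0 : 1 + z * σ z ≠ 0 := fun h0 => by rw [h0, map_zero] at h1Nz1; exact zero_ne_one h1Nz1
  have hσu : σ (c / (1 + z * σ z)) = c / (1 + z * σ z) := by rw [map_div₀, hσc, map_add, map_one, map_mul_map hσ]
  have hu1 : Valued.v (c / (1 + z * σ z) - 1) ≤ Valued.v ϖ ^ (2 * d - 1) := by
    rw [div_sub_one h1Nz0, show c - (1 + z * σ z) = y₀ - z * σ z by rw [hy₀]; ring, map_div₀, h1Nz1, div_one, v_varpi_pow hϖ]
    exact hdiff.trans (by rw [exp_le_exp]; omega)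
  obtain ⟨s, hs⟩ := exists_mul_map_eq_of_fixed_of_v_sub_one_le_pred hD hσu (n := 2 * d - 1) le_rfl hu1
  -- (5) `1 + Nz` is a non-norm
  have h1N : ¬ ∃ z' : K, z' * σ z' = 1 + z * σ z := by
    rintro ⟨z', hz'⟩
    refine hcN ⟨s * z', ?_⟩
    rw [map_mul, mul_mul_mul_comm, hs, hz', div_mul_cancel₀ _ h1Nz0]
  -- (6) index two: `ξ (1 + Nz) = N a₀`
  obtain ⟨c₀, hσc₀, hc₀N, hdich⟩ := exists_nonnorm_dichotomy hD
  have hξ0 : ξ ≠ 0 := fun h0 => by rw [h0, map_zero] at hξ1; exact zero_ne_one hξ1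
  have hc₀0 : c₀ ≠ 0 := by rintro rfl; exact hc₀N ⟨0, by rw [zero_mul]⟩
  have hσ1N : σ (1 + z * σ z) = 1 + z * σ z := by rw [map_add, map_one, map_mul_map hσ]
  obtain ⟨s₁, hs₁⟩ := (hdich ξ hσξ hξ0).resolve_left hξN
  obtain ⟨s₂, hs₂⟩ := (hdich _ hσ1N h1Nz0).resolve_left h1N
  refine ⟨s₁ * s₂ / c₀, z, ?_, ?_, ?_⟩
  · -- `|a₀| = 1`
    have hN : Valued.v (s₁ * s₂ / c₀ * σ (s₁ * s₂ / c₀)) = 1 := by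
      have e : s₁ * s₂ / c₀ * σ (s₁ * s₂ / c₀) = (s₁ * σ s₁) * (s₂ * σ s₂) / (c₀ * c₀) := by rw [map_div₀, map_mul, hσc₀]; ring
      rw [e, hs₁, hs₂, show c₀ * ξ * (c₀ * (1 + z * σ z)) / (c₀ * c₀) = ξ * (1 + z * σ z) by field_simp, map_mul, hξ1, h1Nz1, mul_one]
    exact (v_eq_one_of_v_mul_map_eq_one hvσ hN).le
  · rw [hz, map_mul, map_pow, hϖ, hz₁1, mul_one, ← exp_nsmul, nsmul_eq_mul, mul_neg, mul_one, ← exp_zero, exp_le_exp]; omega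
  · have e : s₁ * s₂ / c₀ * σ (s₁ * s₂ / c₀) = (s₁ * σ s₁) * (s₂ * σ s₂) / (c₀ * c₀) := by rw [map_div₀, map_mul, hσc₀]; ring
    rw [e, hs₁, hs₂]
    field_simp
    ring

/-- **EVERY `σ`-FIXED UNIT IS THE REDUCED NORM OF AN INTEGRAL PAIR** (`nrd(Λ^×) = U_F = nrd(𝒪^×)`): for `σ τ = τ`, `|τ| = 1`: `∃ a, b ∈ 𝒪_E`, `N a − ξ N b = τ` — `τ = N s` (`q(s,0)`) or, by index two (★ `exists_nonnorm_dichotomy`), `τ = ξ·N s` and `(a, b) = (a₀ s, z s)` with the previous lemma's `(a₀, z)`. [cite: Serre1979, Ch. V §3 Prop. 5, Cor. 3] -/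
theorem exists_integral_norm_sub_mul_norm_eq [CompleteSpace K] [Finite 𝓀[K]] (hD : IsRamifiedQuadraticDatum σ ϖ d t) (h2 : Valued.v (2 : K) < 1)
    {ξ : K} (hσξ : σ ξ = ξ) (hξ1 : Valued.v ξ = 1) (hξN : ¬ ∃ z : K, z * σ z = ξ) {τ : K} (hστ : σ τ = τ) (hτ1 : Valued.v τ = 1) :
    ∃ a b : K, Valued.v a ≤ 1 ∧ Valued.v b ≤ 1 ∧ a * σ a - ξ * (b * σ b) = τ := by
  have hD' := hD
  obtain ⟨hσ, hvσ, -, -, -, -, -⟩ := hD'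
  have hτ0 : τ ≠ 0 := fun h0 => by rw [h0, map_zero] at hτ1; exact zero_ne_one hτ1
  have hξ0 : ξ ≠ 0 := fun h0 => by rw [h0, map_zero] at hξ1; exact zero_ne_one hξ1
  obtain ⟨c₀, hσc₀, hc₀N, hdich⟩ := exists_nonnorm_dichotomy hD
  rcases hdich τ hστ hτ0 with ⟨s, hs⟩ | ⟨s₁, hs₁⟩
  · refine ⟨s, 0, (v_eq_one_of_v_mul_map_eq_one hvσ (by rw [hs, hτ1])).le, by rw [map_zero]; exact zero_le_one, ?_⟩
    rw [map_zero, mul_zero, mul_zero, sub_zero, hs]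
  · obtain ⟨s₂, hs₂⟩ := (hdich ξ hσξ hξ0).resolve_left hξN
    obtain ⟨a₀, z, ha₀, hz, h⟩ := exists_integral_norm_sub_mul_norm_eq_self hD h2 hσξ hξ1 hξN
    have hs₂0 : s₂ ≠ 0 := by rintro rfl; rw [zero_mul] at hs₂; exact mul_ne_zero (by rintro rfl; exact hc₀N ⟨0, by rw [zero_mul]⟩) hξ0 hs₂.symm
    -- `τ = ξ · N(s₁ ∕ s₂)`
    set s := s₁ / s₂ with hsdef
    have hc₀0 : c₀ ≠ 0 := by rintro rfl; exact hc₀N ⟨0, by rw [zero_mul]⟩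
    have hNs : s * σ s * ξ = τ := by
      rw [hsdef, map_div₀, div_mul_div_comm, hs₁, hs₂, div_mul_eq_mul_div, div_eq_iff (mul_ne_zero hc₀0 hξ0)]
      ring
    have hs1 : Valued.v s = 1 := v_eq_one_of_v_mul_map_eq_one hvσ (by
      have := congrArg Valued.v hNs; rw [map_mul, hξ1, mul_one, hτ1] at this; exact this)
    refine ⟨a₀ * s, z * s, ?_, ?_, ?_⟩
    · rw [map_mul, hs1, mul_one]; exact ha₀
    · rw [map_mul, hs1, mul_one]; exact hz
    · calc a₀ * s * σ (a₀ * s) - ξ * (z * s * σ (z * s)) = s * σ s * (a₀ * σ a₀ - ξ * (z * σ z)) := by rw [map_mul, map_mul]; ring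
        _ = τ := by rw [h, hNs]

end Datum

end Summit.HodgeConjecture.HodgeConjecture.Cruxes.H413.K2E3WildQuaternionOrder

end
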